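import Mathlib
import Summits.Ventures.PercRepro.TriangleCapCapTGenMain
import Summits.Ventures.PercRepro.TriangleCapRowTGenPieces
import Summits.Ventures.PercRepro.TriangleCapBelowWitnessAll
import Summits.Ventures.PercRepro.TriangleCapTFamilyGen

/-!
# PercRepro — THE ROWS `r = a − 2` AND `r = a − 1` OF THE STABILITY TABLE FOR EVERY `5 ≤ a ≤ 18`: on the cell
`(k, a, a − 2)` (`k ≥ 3a − 2`) and on the cell `(k, a, a − 1)` (`k ≥ 3a`) every `K₄⁻`-free graph that is not
`a`-bipartite is at least `2 (k − 2a − 1)` below the closed form — the one-triangle family `T` resp. the family `B2`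
attain it (p3, gen 47; part 200i)

NO INDUCTION ON `k`: a vertex at the cap is part 200g (`cap_T_gen`); every degree in `[a, k − a − 1]` is the window
(`rowT_window`, since `2r ≥ a`); a vertex `z` of degree `d ≤ a − 1` is deleted — across the row (`below_cross_gen`,
`r + d + 1 ≤ a`) or onto the cell `(k − 1, a, r + d − a)`: a `B2` cell (`r + d − a ≤ a − 3`, part 200d, every
`a ≤ 18`) or, on the `B2` row with `d = a − 1`, the `T` cell `(k − 1, a, a − 2)` (this module's first theorem);
an `a`-bipartite `D − z` is read through `sides_T_gen`, a non-bipartite one through `below_within_assemble`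
(part 196c) resp. `rowB_T_arith`. `rowT_nonbip_second_best` / `rowB_nonbip_second_best`: the non-`a`-bipartite
second-best values are EXACTLY `m k − r (k − 1 − r) − 2 (k − 2a − 1)`, attained by `tFamilyGen (k − 1) a 0` resp.
`bipMinusStar k (a + 1) (k − a − 2)`; `second_best_T_cells`: THE SECOND-BEST VALUE OF THE CHERRY TABLE on these
cells is `closed − 2 (r − 2)` (the brooms). Axioms: standard.
-/

namespace PercRepro

namespace TriangleCap

namespace C047

open Finset

variable {V : Type*} [Fintype V] [DecidableEq V]

/-- **THE ROW `r = a − 2`, `5 ≤ a ≤ 18`, `k ≥ 3a − 2`:** `K₄⁻`-free, `m + r = a (k − a)` ⇒ `a`-bipartite or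
`Σ_v d(v)² + r (k − 1 − r) + 2 (k − 2a − 1) ≤ m k`. -/
theorem rowT_second_order_gen (D : SimpleGraph V) [DecidableRel D.Adj] (hK : K4mFree D) (a r : ℕ)
    (ha5 : 5 ≤ a) (ha18 : a ≤ 18) (hr : r + 2 = a) (hk : 2 * a + r ≤ Fintype.card V)
    (hm : D.edgeFinset.card + r = a * (Fintype.card V - a)) :
    (∃ A : Finset V, A.card = a ∧ BipSub D A) ∨
      ∑ v, deg D v * deg D v + r * (Fintype.card V - 1 - r) + 2 * (Fintype.card V - 2 * a - 1) ≤
        D.edgeFinset.card * Fintype.card V := by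
  have hk2 : 2 * a + 2 ≤ Fintype.card V := by omega
  -- (A) a vertex at the cap
  by_cases hx : ∃ x, deg D x + a = Fintype.card V
  · obtain ⟨x, hx⟩ := hx
    exact cap_T_gen D hK a r ha5 (by omega) (by omega) hk hm (by omega) x hx
  push Not at hx
  have hcap : ∀ v, deg D v + a ≤ Fintype.card V := fun v =>
    deg_add_le_card_of_dense D hK a (by omega) (by omega)
      (cap_arith a (Fintype.card V) D.edgeFinset.card r (by omega) hk
        (below_cap_arith a (Fintype.card V) D.edgeFinset.card r (by omega) hm)) v
  have hcap' : ∀ v, deg D v + a + 1 ≤ Fintype.card V := fun v => by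
    have h1 := hcap v
    have h2 := hx v
    omega
  have hcap2 : ∀ v, deg D v ≤ (Fintype.card V - a - 2) + 1 := fun v => by have := hcap' v; omega
  -- (B) every degree `≥ a`: the window
  by_cases hdeg : ∀ v, a ≤ deg D v
  · exact Or.inr (rowT_window D a r (by omega) (by omega) (by omega) hm hcap' hdeg)
  push Not at hdeg
  obtain ⟨z, hz⟩ := hdeg
  -- (C) `d ≤ 1`: the cross-row deletion
  rcases Nat.lt_or_ge (r + deg D z) a with hz1 | hz2
  · right
    have h := below_cross_gen D hK a r (by omega) hk2 hm hcap' z (by omega)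
    have e : a - r = 2 := by omega
    rw [e] at h
    omega
  -- (D) `2 ≤ d ≤ a − 1`: onto the `B2` cell `(k − 1, a, d − 2)`
  obtain ⟨r', hr'⟩ : ∃ r', r + deg D z = a + r' := ⟨r + deg D z - a, by omega⟩
  have hK' := k4mFree_del D hK z
  have hcard' := card_del z
  have hedges' := card_edges_del D z
  have hsq := sum_deg_sq_del D z
  have hT := sum_del_nbhd_le D z (Fintype.card V - a - 2) hcap2
  obtain ⟨T, hTdef⟩ : ∃ T, ∑ w : {v : V // v ≠ z}, (if D.Adj w.1 z then deg (del D z) w else 0) = T := ⟨_, rfl⟩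
  obtain ⟨S', hS'def⟩ : ∃ S', ∑ w : {v : V // v ≠ z}, deg (del D z) w * deg (del D z) w = S' := ⟨_, rfl⟩
  obtain ⟨m', hm'def⟩ : ∃ m', (del D z).edgeFinset.card = m' := ⟨_, rfl⟩
  rw [hTdef, hS'def] at hsq
  rw [hTdef] at hT
  rw [hm'def] at hedges'
  have hcardV' : Fintype.card {v : V // v ≠ z} = Fintype.card V - 1 := by omega
  have hm' : (del D z).edgeFinset.card + r' = a * (Fintype.card {v : V // v ≠ z} - a) := by
    rw [hm'def, hcardV']
    exact below_cell_edges a r r' (deg D z) (Fintype.card V) D.edgeFinset.card m' hk2 hr' hedges' hm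
  have hmd : m' + deg D z + r = a * (Fintype.card V - a) := by omega
  rcases below_second_order_all (del D z) hK' a r' (by omega) ha18 (by omega) (by omega) hm'
    with ⟨A', hA'card, hB⟩ | hgap
  · rcases sides_T_gen D a r (by omega) hk2 hm z A' hA'card hB hcap2 with h | h | hT'
    · exact Or.inl h
    · exact Or.inr h
    · right
      have hS := sum_deg_sq_le_of_bipSub (del D z) A' hB a r' hA'card hm' (by omega)
      rw [hS'def, hm'def, hcardV'] at hS
      rw [hTdef] at hT'
      rw [hsq, ← hedges']
      exact rowT_mixed_arith a r r' (deg D z) (Fintype.card V) m' S' T ha5 hr (by omega) (by omega) hk hr' hmd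
        hS hT'
  · right
    rw [hS'def, hm'def, hcardV'] at hgap
    have h := below_within_assemble a r r' (deg D z) (Fintype.card V) m' S' T hk2 (by omega) hr' (by omega) hmd
      hgap hT
    rw [hsq, ← hedges']
    have e : a - r = 2 := by omega
    rw [e] at h
    omega

/-- **THE ROW `r = a − 1`, `5 ≤ a ≤ 18`, `k ≥ 3a`:** `K₄⁻`-free, `m + r = a (k − a)` ⇒ `a`-bipartite or
`Σ_v d(v)² + r (k − 1 − r) + 2 (k − 2a − 1) ≤ m k`. -/
theorem rowB_second_order_gen (D : SimpleGraph V) [DecidableRel D.Adj] (hK : K4mFree D) (a r : ℕ)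
    (ha5 : 5 ≤ a) (ha18 : a ≤ 18) (hr : r + 1 = a) (hk : 2 * a + r + 1 ≤ Fintype.card V)
    (hm : D.edgeFinset.card + r = a * (Fintype.card V - a)) :
    (∃ A : Finset V, A.card = a ∧ BipSub D A) ∨
      ∑ v, deg D v * deg D v + r * (Fintype.card V - 1 - r) + 2 * (Fintype.card V - 2 * a - 1) ≤
        D.edgeFinset.card * Fintype.card V := by
  have hk2 : 2 * a + 2 ≤ Fintype.card V := by omega
  -- (A) a vertex at the cap
  by_cases hx : ∃ x, deg D x + a = Fintype.card V
  · obtain ⟨x, hx⟩ := hx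
    exact cap_T_gen D hK a r ha5 (by omega) (by omega) (by omega) hm (by omega) x hx
  push Not at hx
  have hcap : ∀ v, deg D v + a ≤ Fintype.card V := fun v =>
    deg_add_le_card_of_dense D hK a (by omega) (by omega)
      (cap_arith a (Fintype.card V) D.edgeFinset.card r (by omega) (by omega)
        (below_cap_arith a (Fintype.card V) D.edgeFinset.card r (by omega) hm)) v
  have hcap' : ∀ v, deg D v + a + 1 ≤ Fintype.card V := fun v => by
    have h1 := hcap v
    have h2 := hx v
    omega
  have hcap2 : ∀ v, deg D v ≤ (Fintype.card V - a - 2) + 1 := fun v => by have := hcap' v; omega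
  -- (B) every degree `≥ a`: the window
  by_cases hdeg : ∀ v, a ≤ deg D v
  · exact Or.inr (rowT_window D a r (by omega) (by omega) (by omega) hm hcap' hdeg)
  push Not at hdeg
  obtain ⟨z, hz⟩ := hdeg
  -- (C) `d = 0`: the cross-row deletion, exactly the target
  rcases Nat.lt_or_ge (r + deg D z) a with hz1 | hz2
  · right
    have h := below_cross_gen D hK a r (by omega) hk2 hm hcap' z (by omega)
    have e : a - r = 1 := by omega
    rw [e, mul_one] at h
    exact h
  -- (D) `1 ≤ d ≤ a − 1`: onto the cell `(k − 1, a, d − 1)`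
  obtain ⟨r', hr'⟩ : ∃ r', r + deg D z = a + r' := ⟨r + deg D z - a, by omega⟩
  have hK' := k4mFree_del D hK z
  have hcard' := card_del z
  have hedges' := card_edges_del D z
  have hsq := sum_deg_sq_del D z
  have hT := sum_del_nbhd_le D z (Fintype.card V - a - 2) hcap2
  obtain ⟨T, hTdef⟩ : ∃ T, ∑ w : {v : V // v ≠ z}, (if D.Adj w.1 z then deg (del D z) w else 0) = T := ⟨_, rfl⟩
  obtain ⟨S', hS'def⟩ : ∃ S', ∑ w : {v : V // v ≠ z}, deg (del D z) w * deg (del D z) w = S' := ⟨_, rfl⟩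
  obtain ⟨m', hm'def⟩ : ∃ m', (del D z).edgeFinset.card = m' := ⟨_, rfl⟩
  rw [hTdef, hS'def] at hsq
  rw [hTdef] at hT
  rw [hm'def] at hedges'
  have hcardV' : Fintype.card {v : V // v ≠ z} = Fintype.card V - 1 := by omega
  have hm' : (del D z).edgeFinset.card + r' = a * (Fintype.card {v : V // v ≠ z} - a) := by
    rw [hm'def, hcardV']
    exact below_cell_edges a r r' (deg D z) (Fintype.card V) D.edgeFinset.card m' hk2 hr' hedges' hm
  have hmd : m' + deg D z + r = a * (Fintype.card V - a) := by omega
  -- the side lemma, shared by every `d`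
  have hside : ∀ A' : Finset {v : V // v ≠ z}, A'.card = a → BipSub (del D z) A' →
      (∃ A : Finset V, A.card = a ∧ BipSub D A) ∨
        (∑ v, deg D v * deg D v + r * (Fintype.card V - 1 - r) + 2 * (Fintype.card V - 2 * a - 1) ≤
          D.edgeFinset.card * Fintype.card V) ∨
        (T + (Fintype.card V - a - 2) ≤ deg D z * (Fintype.card V - a - 2) + a) := by
    intro A' hA'card hB
    have := sides_T_gen D a r (by omega) hk2 hm z A' hA'card hB hcap2
    rw [hTdef] at this
    exact this
  rcases Nat.lt_or_ge (deg D z + 1) a with hda | hda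
  · -- `d ≤ a − 2`: the `B2` cell `(k − 1, a, d − 1)`
    rcases below_second_order_all (del D z) hK' a r' (by omega) ha18 (by omega) (by omega) hm'
      with ⟨A', hA'card, hB⟩ | hgap
    · rcases hside A' hA'card hB with h | h | hT'
      · exact Or.inl h
      · exact Or.inr h
      · right
        rcases Nat.lt_or_ge (deg D z) 2 with hd1 | hd2
        · -- `d = 1`: the envelope read, exactly the family `B2`
          have hd1' : deg D z = 1 := by omega
          have henv := sum_deg_sq_le_of_k4mFree (del D z) hK' (by omega)
          rw [hS'def, hm'def, hcardV'] at henv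
          rw [hd1'] at hT' hedges'
          rw [hsq, ← hedges', hd1']
          exact rowB_env_arith a r (Fintype.card V) m' S' T ha5 hr (by omega) (by rw [hd1'] at hmd; exact hmd)
            henv hT'
        · have hS := sum_deg_sq_le_of_bipSub (del D z) A' hB a r' hA'card hm' (by omega)
          rw [hS'def, hm'def, hcardV'] at hS
          rw [hsq, ← hedges']
          exact rowB_mixed_arith a r r' (deg D z) (Fintype.card V) m' S' T ha5 hr hd2 (by omega) (by omega) hr'
            hmd hS hT'
    · right
      rw [hS'def, hm'def, hcardV'] at hgap
      have h := below_within_assemble a r r' (deg D z) (Fintype.card V) m' S' T hk2 (by omega) hr' (by omega)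
        hmd hgap hT
      rw [hsq, ← hedges']
      have e : a - r = 1 := by omega
      rw [e, mul_one] at h
      exact h
  · -- `d = a − 1`: the `T` cell `(k − 1, a, a − 2)`
    have hda' : deg D z = a - 1 := by omega
    have hr'' : r' = a - 2 := by omega
    subst hr''
    rcases rowT_second_order_gen (del D z) hK' a (a - 2) ha5 ha18 (by omega) (by omega) hm'
      with ⟨A', hA'card, hB⟩ | hgap
    · rcases hside A' hA'card hB with h | h | hT'
      · exact Or.inl h
      · exact Or.inr h
      · right
        have hS := sum_deg_sq_le_of_bipSub (del D z) A' hB a (a - 2) hA'card hm' (by omega)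
        rw [hS'def, hm'def, hcardV'] at hS
        rw [hsq, ← hedges']
        exact rowB_mixed_arith a r (a - 2) (deg D z) (Fintype.card V) m' S' T ha5 hr (by omega) (by omega)
          (by omega) hr' hmd hS hT'
    · right
      rw [hS'def, hm'def, hcardV'] at hgap
      rw [hda'] at hT hedges' hmd
      rw [hsq, ← hedges', hda']
      exact rowB_T_arith a r (Fintype.card V) m' S' T ha5 hr (by omega) hmd hgap hT

/-- **THE NON-BIPARTITE SECOND-BEST VALUE ON THE CELL `(k, a, a − 2)`, `5 ≤ a ≤ 18`, `3a − 2 ≤ k`:** EXACTLY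
`m k − (a − 2)(k − a + 1) − 2 (k − 2a − 1)`, attained by the one-triangle family `tFamilyGen (k − 1) a 0`. -/
theorem rowT_nonbip_second_best (k a : ℕ) (ha5 : 5 ≤ a) (ha18 : a ≤ 18) (hk : 3 * a ≤ k + 2) :
    (∀ (D : SimpleGraph (Fin k)) [DecidableRel D.Adj], K4mFree D → D.edgeFinset.card + (a - 2) = a * (k - a) →
        (¬ ∃ A : Finset (Fin k), A.card = a ∧ BipSub D A) →
        ∑ v, deg D v * deg D v + (a - 2) * (k - 1 - (a - 2)) + 2 * (k - 2 * a - 1) ≤ D.edgeFinset.card * k) ∧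
      ∃ (D : SimpleGraph (Fin k)) (_ : DecidableRel D.Adj), K4mFree D ∧ D.edgeFinset.card + (a - 2) = a * (k - a) ∧
        (¬ ∃ A : Finset (Fin k), A.card = a ∧ BipSub D A) ∧
        ∑ v, deg D v * deg D v + (a - 2) * (k - 1 - (a - 2)) + 2 * (k - 2 * a - 1) = D.edgeFinset.card * k := by
  have hcard : Fintype.card (Fin k) = k := Fintype.card_fin k
  refine ⟨?_, ?_⟩
  · intro D _ hK hm hnb
    rcases rowT_second_order_gen D hK a (a - 2) ha5 ha18 (by omega) (by rw [hcard]; omega) (by rw [hcard]; exact hm)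
      with h | h
    · exact absurd h hnb
    · rw [hcard] at h
      exact h
  · obtain ⟨n, rfl⟩ : ∃ n, k = n + 1 := ⟨k - 1, by omega⟩
    obtain ⟨hK, hE, hS, hnb⟩ := tFamilyGen_value n a 0 (by omega) (by omega) (by omega)
    refine ⟨tFamilyGen n a 0 (by omega), inferInstance, hK, ?_, fun ⟨A, _, hB⟩ => hnb A hB, ?_⟩
    · have e : 0 + a - 2 = a - 2 := by omega
      rw [e] at hE
      exact hE
    · have e : 0 + a - 2 = a - 2 := by omega
      rw [e] at hS
      simp only [mul_zero, zero_mul, add_zero] at hS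
      have e2 : 2 * (n - 2 * a) = 2 * (n + 1 - 2 * a - 1) := by omega
      rw [e2] at hS
      exact hS

/-- The degree of a small-side vertex of `bipMinusStar k (a + 1) s` at the value `k − a − 1`: packaged for the
witness of the `B2` row. -/
theorem rowB_witness (k a : ℕ) (ha5 : 5 ≤ a) (hk : 3 * a ≤ k) :
    K4mFree (bipMinusStar k (a + 1) (k - a - 2)) ∧
      (bipMinusStar k (a + 1) (k - a - 2)).edgeFinset.card + (a - 1) = a * (k - a) ∧
      (¬ ∃ A : Finset (Fin k), A.card = a ∧ BipSub (bipMinusStar k (a + 1) (k - a - 2)) A) ∧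
      ∑ v, deg (bipMinusStar k (a + 1) (k - a - 2)) v * deg (bipMinusStar k (a + 1) (k - a - 2)) v +
          (a - 1) * (k - 1 - (a - 1)) + 2 * (k - 2 * a - 1) =
        (bipMinusStar k (a + 1) (k - a - 2)).edgeFinset.card * k := by
  have hE := card_edges_bipMinusStar k (a + 1) (k - a - 2) (by omega) (by omega)
  have hS := (sums_bipMinusStar k (a + 1) (k - a - 2) (by omega) (by omega)).2
  refine ⟨k4mFree_bipMinusStar _ _ _, ?_, not_bipSub_bipMinusStar_small k a (k - a - 2) (by omega) (by omega), ?_⟩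
  · obtain ⟨q, rfl⟩ : ∃ q, a = q + 5 := ⟨a - 5, by omega⟩
    obtain ⟨c, rfl⟩ : ∃ c, k = 3 * (q + 5) + c := ⟨k - 3 * (q + 5), by omega⟩
    have e1 : 3 * (q + 5) + c - (q + 5 + 1) = 2 * q + 9 + c := by omega
    have e2 : 3 * (q + 5) + c - (q + 5) - 2 = 2 * q + 8 + c := by omega
    have e3 : 3 * (q + 5) + c - (q + 5) = 2 * q + 10 + c := by omega
    have e4 : q + 5 - 1 = q + 4 := by omega
    rw [e1, e2] at hE
    rw [e2, e3, e4]
    nlinarith [hE]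
  · obtain ⟨S, hSdef⟩ : ∃ S, ∑ v, deg (bipMinusStar k (a + 1) (k - a - 2)) v *
        deg (bipMinusStar k (a + 1) (k - a - 2)) v = S := ⟨_, rfl⟩
    obtain ⟨E, hEdef⟩ : ∃ E, (bipMinusStar k (a + 1) (k - a - 2)).edgeFinset.card = E := ⟨_, rfl⟩
    rw [hSdef] at hS
    rw [hEdef] at hE
    rw [hSdef, hEdef]
    obtain ⟨q, rfl⟩ : ∃ q, a = q + 5 := ⟨a - 5, by omega⟩
    obtain ⟨c, rfl⟩ : ∃ c, k = 3 * (q + 5) + c := ⟨k - 3 * (q + 5), by omega⟩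
    have e1 : 3 * (q + 5) + c - (q + 5 + 1) = 2 * q + 9 + c := by omega
    have e2 : 3 * (q + 5) + c - (q + 5) - 2 = 2 * q + 8 + c := by omega
    have e3 : 2 * (3 * (q + 5) + c) - (2 * q + 8 + c) - 1 = 4 * q + 21 + c := by omega
    have e4 : q + 5 - 1 = q + 4 := by omega
    have e5 : 3 * (q + 5) + c - 1 - (q + 4) = 2 * q + 10 + c := by omega
    have e6 : 3 * (q + 5) + c - 2 * (q + 5) - 1 = q + 4 + c := by omega
    rw [e1, e2] at hE hS
    rw [e3] at hS
    rw [e4, e5, e6]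
    zify at hE hS ⊢
    linear_combination hS - (3 * ((q : ℤ) + 5) + c) * hE

/-- **THE NON-BIPARTITE SECOND-BEST VALUE ON THE CELL `(k, a, a − 1)`, `5 ≤ a ≤ 18`, `3a ≤ k`:** EXACTLY
`m k − (a − 1)(k − a) − 2 (k − 2a − 1)`, attained by the family `B2`. -/
theorem rowB_nonbip_second_best (k a : ℕ) (ha5 : 5 ≤ a) (ha18 : a ≤ 18) (hk : 3 * a ≤ k) :
    (∀ (D : SimpleGraph (Fin k)) [DecidableRel D.Adj], K4mFree D → D.edgeFinset.card + (a - 1) = a * (k - a) →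
        (¬ ∃ A : Finset (Fin k), A.card = a ∧ BipSub D A) →
        ∑ v, deg D v * deg D v + (a - 1) * (k - 1 - (a - 1)) + 2 * (k - 2 * a - 1) ≤ D.edgeFinset.card * k) ∧
      ∃ (D : SimpleGraph (Fin k)) (_ : DecidableRel D.Adj), K4mFree D ∧ D.edgeFinset.card + (a - 1) = a * (k - a) ∧
        (¬ ∃ A : Finset (Fin k), A.card = a ∧ BipSub D A) ∧
        ∑ v, deg D v * deg D v + (a - 1) * (k - 1 - (a - 1)) + 2 * (k - 2 * a - 1) = D.edgeFinset.card * k := by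
  have hcard : Fintype.card (Fin k) = k := Fintype.card_fin k
  refine ⟨?_, ?_⟩
  · intro D _ hK hm hnb
    rcases rowB_second_order_gen D hK a (a - 1) ha5 ha18 (by omega) (by rw [hcard]; omega) (by rw [hcard]; exact hm)
      with h | h
    · exact absurd h hnb
    · rw [hcard] at h
      exact h
  · obtain ⟨hK, hE, hnb, hS⟩ := rowB_witness k a ha5 hk
    exact ⟨_, inferInstance, hK, hE, hnb, hS⟩

/-- **THE SECOND-BEST VALUE OF THE CHERRY TABLE ON THE CELLS `(k, a, a − 2)` AND `(k, a, a − 1)`, `5 ≤ a ≤ 18`,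
`3a ≤ k`:** `closed − 2 (r − 2)` (the brooms): the bipartite graphs are `≥ 2 (r − 2)` below unless they miss a star
(then extremal), the others `≥ 2 (k − 2a − 1) ≥ 2 (r − 2)` below. -/
theorem second_best_T_cells (k a r : ℕ) (ha5 : 5 ≤ a) (ha18 : a ≤ 18) (hr : r + 2 = a ∨ r + 1 = a) (hk : 3 * a ≤ k) :
    (∀ (D : SimpleGraph (Fin k)) [DecidableRel D.Adj], K4mFree D → D.edgeFinset.card + r = a * (k - a) →
        ∑ v, deg D v * deg D v + r * (k - 1 - r) ≠ D.edgeFinset.card * k →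
        ∑ v, deg D v * deg D v + r * (k - 1 - r) + 2 * (r - 2) ≤ D.edgeFinset.card * k) ∧
      ∃ (D : SimpleGraph (Fin k)) (_ : DecidableRel D.Adj), K4mFree D ∧ D.edgeFinset.card + r = a * (k - a) ∧
        ∑ v, deg D v * deg D v + r * (k - 1 - r) + 2 * (r - 2) = D.edgeFinset.card * k := by
  have hcard : Fintype.card (Fin k) = k := Fintype.card_fin k
  refine ⟨?_, ?_⟩
  · intro D _ hK hm hne
    have hmain : (∃ A : Finset (Fin k), A.card = a ∧ BipSub D A) ∨
        ∑ v, deg D v * deg D v + r * (k - 1 - r) + 2 * (k - 2 * a - 1) ≤ D.edgeFinset.card * k := by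
      rcases hr with hr | hr
      · have := rowT_second_order_gen D hK a r ha5 ha18 hr (by rw [hcard]; omega) (by rw [hcard]; exact hm)
        rw [hcard] at this
        exact this
      · have := rowB_second_order_gen D hK a r ha5 ha18 hr (by rw [hcard]; omega) (by rw [hcard]; exact hm)
        rw [hcard] at this
        exact this
    rcases hmain with ⟨A, hAcard, hB⟩ | h
    · by_cases hstar : ∃ v, MissingStar D A v
      · obtain ⟨v, hv⟩ := hstar
        have h := closed_form_eq_of_missingStar D A hB hv a r hAcard (by rw [hcard]; exact hm) (by rw [hcard]; omega)
        rw [hcard] at h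
        exact absurd h hne
      · have h := closed_form_stability_bipSub D A hB a r hAcard (by rw [hcard]; exact hm) (by rw [hcard]; omega)
          (by omega) hstar
        rw [hcard] at h
        exact h
    · omega
  · obtain ⟨D, inst, A, hK, hAcard, hB, hns, hE, hS⟩ := broom_value k a r (by omega) (by omega) (by omega)
    have hr' : r ≤ a * (k - a) := by
      have h1 : a + r ≤ k - a := by omega
      have h2 : a * (a + r) ≤ a * (k - a) := Nat.mul_le_mul_left a h1
      nlinarith [h2]
    have hE' : D.edgeFinset.card + r = a * (k - a) := by rw [hE]; omega
    refine ⟨D, inst, hK, hE', ?_⟩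
    rw [hE]
    exact hS

end C047

end TriangleCap

end PercRepro
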